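/-
Copyright: statement-level skeleton of a published paper (lit-balaban cell, Phase-2 proof seat p19, gen 3). No claims beyond
what the kernel checks below.
-/
import Mathlib
import Literature.MathematicalPhysics.QuantumFieldTheory.Balaban1983to89.B3Ineq215CubeGeometry

/-!
# B3 — T. Bałaban, *(Higgs)₂,₃ quantum fields in a finite volume. III. Renormalization*, CMP **88** (1983) 411–445
[Balaban1983Higgs3] — Sect. 2, p. 426: the η-lattice points inside the multiscale cubes (the localization step of the
first estimate (2.13))

statement-level skeleton of published theorems with citation tags; proofs where landed; nothing here is a claim about
the Yang–Mills mass gap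

PDF held: `paper:balaban1983-higgs-2-3-quantum-fields-finite-volume` (journal page = PDF page + 410); displays read on
the ×2 renders `pub-balaban/b2b-balaban-ref1/pages/1983-cmp88-higgs23-III/1983-cmp88-higgs23-III-p016, p017-x2.png`
(pp. 426, 427).

Part of the Phase-2 proof of SKELETON row **B3.Eq2.13-2.14** (unit `lit-balaban-p19` gen 3, HOME
`run/shared/lean/pub/lit-balaban/`): files `B3Ineq213Points` → `B3Ineq213TreeLength` → `B3Ineq213Proof` (the theorem
`Amp.ineq213`), sub-namespace `…Balaban1983to89.B3Ineq213`, on the concrete multiscale cubes `B3Ineq215.Cube` of the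
gen-2 proof of (2.15) (`B3Ineq215CubeGeometry`).

WHAT IS REPRODUCED.  p. 426 [PDF 16]: *"We localize further the expression to cubes Δ(v) of the size L^{j(v)}η, i.e. we have
Σ_{x(or b)∈□(v)} η^d … = Σ_{Δ(v)⊂□(v)} (L^{j(v)}η)^d …"* and *"For each line we extract a part of the exponential factors on
the right sides of (2.5), (2.10), and (2.12) and we estimate them by exp[−½δ₁dist(□(v), □(v′))], where □(v), □(v′) are
localizations of endpoints of the line"* — the two elementary facts about LATTICE POINTS these sentences use, KERNEL-CHECKED
on the concrete cubes (positions in units of the finest spacing η = L^{−k}; a lattice point `x ∈ ℕ^d` is the scale-0 cube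
`pt x = Π_μ [x_μ, x_μ + 1)`): (a) the points of a cube `A` of scale `s` (`pts L A`, `(L^s)^d` of them, `card_pts`) are
partitioned by the sub-cubes of any intermediate scale `t`, each containing `(L^t)^d` points (`sum_pts_anc`,
`filter_pts_anc_eq`, `card_filter_pts_anc`) — the counting behind `Σ_{x∈□(v)} η^d = Σ_{Δ(v)⊂□(v)} (L^{j(v)}η)^d`; (b) the
sup-distance of two lattice points dominates the distance of any two cubes containing them (`distI_anc_pt_le`) — the fact
behind `exp[−δ(L^jη)^{−1}|x − x′|] ≤ exp[−δ(L^jη)^{−1}dist(Δ(v), Δ(v′))]` for `x ∈ Δ(v)`, `x′ ∈ Δ(v′)`.  Reading choice (as in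
the gen-2 files): distances in the sup-norm of `ηℤ^d` (`supDist`, in η-units); the printed `|x − x′|` is Euclidean, which
is ≥ the sup-norm, so a kernel bound with Euclidean decay implies the sup-norm one used downstream.  Everything here is
elementary and kernel-checked; nothing of the paper is asserted.
-/

open Finset

namespace Literature.MathematicalPhysics.QuantumFieldTheory.Balaban1983to89.B3Ineq213

open B3Ineq215

variable {d : ℕ} (L : ℕ)

/-! ## Lattice points as scale-0 cubes -/

/-- The η-lattice point `x ∈ ℕ^d` (η-units) as the scale-0 cube `Π_μ [x_μ, x_μ + 1)` of the multiscale family of p. 426.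
[cite: Balaban1983Higgs3, (2.14) p.426] -/
def pt (x : Fin d → ℕ) : Cube d := ⟨0, x⟩

/-- The scale of a point is `0`. [cite: Balaban1983Higgs3, (2.14) p.426] -/
@[simp] theorem pt_s (x : Fin d → ℕ) : (pt x).s = 0 := rfl

/-- The position of a point is itself. [cite: Balaban1983Higgs3, (2.14) p.426] -/
@[simp] theorem pt_z (x : Fin d → ℕ) : (pt x).z = x := rfl

/-- A scale-0 cube is the point of its position. [cite: Balaban1983Higgs3, (2.14) p.426] -/
theorem pt_z_eq {c : Cube d} (hc : c.s = 0) : pt c.z = c := by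
  ext
  · simp [hc]
  · simp

/-- The η-lattice points of the cube `A` (p. 426: *"Σ_{x(or b)∈□(v)} η^d …"*): the positions of its scale-0 sub-cubes.
[cite: Balaban1983Higgs3, (2.14) p.426] -/
def pts (A : Cube d) : Finset (Fin d → ℕ) := (Cube.desc L A 0).image Cube.z

variable {L}

/-- Membership: `x` is a point of `A` iff the scale-0 cube `pt x` lies in `A`. [cite: Balaban1983Higgs3, (2.14) p.426] -/
theorem mem_pts_iff (hL : 0 < L) {A : Cube d} {x : Fin d → ℕ} : x ∈ pts L A ↔ pt x ∈ Cube.desc L A 0 := by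
  constructor
  · intro h
    obtain ⟨c, hc, rfl⟩ := mem_image.1 h
    rw [pt_z_eq (Cube.s_of_mem_desc hL hc)]
    exact hc
  · intro h
    exact mem_image.2 ⟨pt x, h, rfl⟩

/-- Membership via the ancestor map: `x ∈ A` iff the scale-`s(A)` cube containing `x` is `A`.
[cite: Balaban1983Higgs3, (2.14) p.426] -/
theorem mem_pts_iff_anc (hL : 0 < L) {A : Cube d} {x : Fin d → ℕ} : x ∈ pts L A ↔ Cube.anc L A.s (pt x) = A := by
  rw [mem_pts_iff hL, Cube.mem_desc_iff_anc hL]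
  simp

/-- A cube of scale `s` has `(L^s)^d` lattice points (its volume in η-units). [cite: Balaban1983Higgs3, (2.14) p.426] -/
theorem card_pts (hL : 0 < L) (A : Cube d) : (pts L A).card = (L ^ A.s) ^ d := by
  unfold pts
  rw [card_image_of_injOn, Cube.card_desc, Nat.sub_zero]
  intro c hc c' hc' h
  have h1 := Cube.s_of_mem_desc hL (mem_coe.1 hc)
  have h2 := Cube.s_of_mem_desc hL (mem_coe.1 hc')
  rw [← pt_z_eq h1, ← pt_z_eq h2]
  exact congrArg pt h

/-- Every cube has a lattice point (`L ≥ 1`). [cite: Balaban1983Higgs3, (2.14) p.426] -/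
theorem pts_nonempty (hL : 0 < L) (A : Cube d) : (pts L A).Nonempty := by
  rw [← card_pos, card_pts hL]
  positivity

/-! ## (a) counting: the points of a cube grouped by the sub-cubes of an intermediate scale -/

/-- p. 426 [PDF 16]: *"Σ_{x(or b)∈□(v)} η^d … = Σ_{Δ(v)⊂□(v)} (L^{j(v)}η)^d …"* — summing a function of the scale-`t` cube
containing the point over the points of `A` counts each scale-`t` sub-cube of `A` exactly `(L^t)^d` times.
[cite: Balaban1983Higgs3, (2.14) p.426] -/
theorem sum_pts_anc (hL : 0 < L) {M : Type*} [AddCommMonoid M] (A : Cube d) {t : ℕ} (ht : t ≤ A.s) (F : Cube d → M) :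
    ∑ x ∈ pts L A, F (Cube.anc L t (pt x)) = ∑ A' ∈ Cube.desc L A t, (L ^ t) ^ d • F A' := by
  unfold pts
  rw [sum_image]
  · have h := Cube.sum_desc_anc hL (Nat.zero_le t) ht F
    rw [Nat.sub_zero] at h
    rw [← h]
    refine sum_congr rfl fun c hc => ?_
    rw [pt_z_eq (Cube.s_of_mem_desc hL hc)]
  · intro c hc c' hc' h
    have h1 := Cube.s_of_mem_desc hL (mem_coe.1 hc)
    have h2 := Cube.s_of_mem_desc hL (mem_coe.1 hc')
    rw [← pt_z_eq h1, ← pt_z_eq h2]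
    exact congrArg pt h

/-- The points of `A` lying in a given scale-`t` sub-cube `A′ ⊂ A` are exactly the points of `A′`.
[cite: Balaban1983Higgs3, (2.14) p.426] -/
theorem filter_pts_anc_eq (hL : 0 < L) {A A' : Cube d} {t : ℕ} (ht : t ≤ A.s) (hA' : A' ∈ Cube.desc L A t) :
    (pts L A).filter (fun x => Cube.anc L t (pt x) = A') = pts L A' := by
  obtain ⟨hs, hanc⟩ := (Cube.mem_desc_iff_anc hL).1 hA'
  ext x
  rw [mem_filter, mem_pts_iff_anc hL, mem_pts_iff_anc hL, hs]
  constructor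
  · rintro ⟨-, h⟩
    exact h
  · intro h
    refine ⟨?_, h⟩
    rw [← Cube.anc_anc (A := pt x) (Nat.zero_le t) ht, h, hanc]

/-- Hence their number is `(L^t)^d`. [cite: Balaban1983Higgs3, (2.14) p.426] -/
theorem card_filter_pts_anc (hL : 0 < L) {A A' : Cube d} {t : ℕ} (ht : t ≤ A.s) (hA' : A' ∈ Cube.desc L A t) :
    ((pts L A).filter (fun x => Cube.anc L t (pt x) = A')).card = (L ^ t) ^ d := by
  rw [filter_pts_anc_eq hL ht hA', card_pts hL, Cube.s_of_mem_desc hL hA']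

/-! ## (b) the sup-distance of lattice points dominates the distance of the cubes containing them -/

/-- The sup-distance `|x − y|_∞` of two lattice points (η-units). [cite: Balaban1983Higgs3, (2.10) p.426] -/
def supDist (x y : Fin d → ℕ) : ℕ := univ.sup fun μ => Nat.dist (x μ) (y μ)

/-- `|x − y|_∞` is symmetric. [cite: Balaban1983Higgs3, (2.10) p.426] -/
theorem supDist_comm (x y : Fin d → ℕ) : supDist x y = supDist y x := by
  unfold supDist
  congr 1
  funext μ
  exact Nat.dist_comm _ _

/-- `|x − x|_∞ = 0`. [cite: Balaban1983Higgs3, (2.10) p.426] -/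
theorem supDist_self (x : Fin d → ℕ) : supDist x x = 0 := by
  unfold supDist
  simp [Nat.dist_self]

/-- Each coordinate difference is at most the sup-distance. [cite: Balaban1983Higgs3, (2.10) p.426] -/
theorem dist_le_supDist (x y : Fin d → ℕ) (μ : Fin d) : Nat.dist (x μ) (y μ) ≤ supDist x y :=
  le_sup (f := fun μ => Nat.dist (x μ) (y μ)) (mem_univ μ)

variable (L) in
/-- The coordinate gap of two points (as scale-0 cubes) is at most their coordinate difference.
[cite: Balaban1983Higgs3, (2.14) p.427] -/
theorem gap_pt_le (x y : Fin d → ℕ) (μ : Fin d) : Cube.gap L (pt x) (pt y) μ ≤ Nat.dist (x μ) (y μ) := by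
  unfold Cube.gap Cube.lo Cube.hi Nat.dist
  simp only [pt_s, pow_zero, one_mul, pt_z]
  omega

variable (L) in
/-- The cube distance of two points is at most their sup-distance. [cite: Balaban1983Higgs3, (2.14) p.427] -/
theorem distI_pt_le (x y : Fin d → ℕ) : Cube.distI L (pt x) (pt y) ≤ supDist x y :=
  Finset.sup_mono_fun fun μ _ => gap_pt_le L x y μ

/-- p. 426: for `x ∈ Δ(v)`, `x′ ∈ Δ(v′)` one has `dist(Δ(v), Δ(v′)) ≤ |x − x′|` — here for the cubes of any scales `t, t′`
containing the two points: `dist(anc_t x, anc_{t′} x′) ≤ |x − x′|_∞` (so that `exp[−δ(L^jη)^{−1}|x − x′|] ≤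
exp[−δ(L^jη)^{−1}dist(Δ(v), Δ(v′))]`). [cite: Balaban1983Higgs3, (2.14) p.426] -/
theorem distI_anc_pt_le (hL : 0 < L) (t t' : ℕ) (x y : Fin d → ℕ) :
    Cube.distI L (Cube.anc L t (pt x)) (Cube.anc L t' (pt y)) ≤ supDist x y :=
  (Cube.distI_anc_le hL (Nat.zero_le t) _).trans
    ((Cube.distI_anc_le_right hL (Nat.zero_le t') _).trans (distI_pt_le L x y))

/-! ## Product localizations: filtering a product family coordinatewise -/

/-- The position tuples `x_v ∈ □(v)` whose localization cubes of the prescribed scales `t(v)` form a given admissible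
family `{Δ(v)}`, `Δ(v) ⊂ □(v)`, are exactly the tuples of points of the `Δ(v)`. [cite: Balaban1983Higgs3, (2.14) p.426] -/
theorem filter_pi_pts_anc_eq (hL : 0 < L) {V : Type*} [Fintype V] [DecidableEq V] (U : V → Cube d) (t : V → ℕ)
    (ht : ∀ v, t v ≤ (U v).s) {Θ : V → Cube d} (hΘ : ∀ v, Θ v ∈ Cube.desc L (U v) (t v)) :
    (Fintype.piFinset fun v => pts L (U v)).filter (fun x => (fun v => Cube.anc L (t v) (pt (x v))) = Θ)
      = Fintype.piFinset fun v => pts L (Θ v) := by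
  ext x
  rw [mem_filter, Fintype.mem_piFinset, Fintype.mem_piFinset, funext_iff]
  constructor
  · rintro ⟨hx, hΘx⟩ v
    exact (Finset.ext_iff.1 (filter_pts_anc_eq hL (ht v) (hΘ v)) (x v)).1 (mem_filter.2 ⟨hx v, hΘx v⟩)
  · intro hx
    have h := fun v => mem_filter.1 ((Finset.ext_iff.1 (filter_pts_anc_eq hL (ht v) (hΘ v)) (x v)).2 (hx v))
    exact ⟨fun v => (h v).1, fun v => (h v).2⟩

/-- p. 426: the number of position tuples `x_v ∈ □(v)` whose localization cubes of the prescribed scales `t(v)` are a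
given admissible family `{Δ(v)}`, `Δ(v) ⊂ □(v)`, is `Π_v (L^{t(v)})^d` — the product form of `Σ_{x∈□(v)} η^d =
Σ_{Δ(v)⊂□(v)} (L^{j(v)}η)^d`. [cite: Balaban1983Higgs3, (2.14) p.426] -/
theorem card_filter_pi_pts_anc (hL : 0 < L) {V : Type*} [Fintype V] [DecidableEq V] (U : V → Cube d) (t : V → ℕ)
    (ht : ∀ v, t v ≤ (U v).s) {Θ : V → Cube d} (hΘ : ∀ v, Θ v ∈ Cube.desc L (U v) (t v)) :
    ((Fintype.piFinset fun v => pts L (U v)).filter (fun x => (fun v => Cube.anc L (t v) (pt (x v))) = Θ)).card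
      = ∏ v, (L ^ t v) ^ d := by
  rw [filter_pi_pts_anc_eq hL U t ht hΘ, Fintype.card_piFinset]
  refine Finset.prod_congr rfl fun v _ => ?_
  rw [card_pts hL, Cube.s_of_mem_desc hL (hΘ v)]

/-- The regrouping identity of p. 426 in product form: summing a function of the localization family `{Δ(v)}` =
`{anc_{t(v)} x_v}` over the position tuples `x_v ∈ □(v)` equals the sum over the admissible families `Δ(v) ⊂ □(v)`,
`|Δ(v)| = (L^{t(v)}η)^d`, weighted by `Π_v (L^{t(v)})^d`. [cite: Balaban1983Higgs3, (2.14) p.426] -/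
theorem sum_pi_pts_anc (hL : 0 < L) {V : Type*} [Fintype V] [DecidableEq V] (U : V → Cube d) {t : V → ℕ}
    (ht : ∀ v, t v ≤ (U v).s) (F : (V → Cube d) → ℝ) :
    ∑ x ∈ Fintype.piFinset (fun v => pts L (U v)), F (fun v => Cube.anc L (t v) (pt (x v)))
      = ∑ Θ ∈ Fintype.piFinset (fun v => Cube.desc L (U v) (t v)), (∏ v, ((L : ℝ) ^ t v) ^ d) * F Θ := by
  have hmaps : ∀ x ∈ Fintype.piFinset (fun v => pts L (U v)),
      (fun v => Cube.anc L (t v) (pt (x v))) ∈ Fintype.piFinset (fun v => Cube.desc L (U v) (t v)) := by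
    intro x hx
    rw [Fintype.mem_piFinset] at hx ⊢
    intro v
    have hxv := hx v
    rw [mem_pts_iff_anc hL] at hxv
    rw [Cube.mem_desc_iff_anc hL]
    refine ⟨rfl, ?_⟩
    rw [Cube.anc_anc (A := pt (x v)) (Nat.zero_le _) (ht v), hxv]
  rw [← Finset.sum_fiberwise_of_maps_to hmaps]
  refine Finset.sum_congr rfl fun Θ hΘ => ?_
  have hΘ' : ∀ v, Θ v ∈ Cube.desc L (U v) (t v) := Fintype.mem_piFinset.1 hΘ
  have hconst : ∀ x ∈ (Fintype.piFinset (fun v => pts L (U v))).filter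
      (fun x => (fun v => Cube.anc L (t v) (pt (x v))) = Θ),
      F (fun v => Cube.anc L (t v) (pt (x v))) = F Θ := by
    intro x hx
    rw [(mem_filter.1 hx).2]
  rw [Finset.sum_congr rfl hconst, Finset.sum_const, card_filter_pi_pts_anc hL U t ht hΘ', nsmul_eq_mul]
  simp only [Nat.cast_prod, Nat.cast_pow]

end Literature.MathematicalPhysics.QuantumFieldTheory.Balaban1983to89.B3Ineq213
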